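import Summits.RiemannHypothesis.RiemannHypothesis.Theorems.TiltedLandingLaw421R3SinkFeedM

/-!
# W-09 far branch · «FarStateRead» — the line remainder READ AT THE STATE by its limit (C4 kernel desk rh-idea-6 g44)

SUPPORT (K only; asserts no law; RH is NOT proved; ⟨33346⟩/⟨33347⟩ OPEN).  ONE import, landed: «SinkFeedM» (#1268; through it #1258's seam read
`RhW08.SinkFeed.norm_lineRem_le_of_seam`, #1254's far comparison `RhW08.FarPricing.norm_sub_far_le`, r1's closed form `RhW08.FLinkGain.lineRem_eq`).

WHY.  #1268's ★3m closes the sink from 102's `CertificatesExistSig lam` only STRICTLY BELOW THE LID `Im v < hmax`: at `Im v = hmax` the top cut point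
`⟨Re v, hmax⟩` of the certificate IS the state `v`, where `lineRem f j v R v` is Lean-junk (`levelField v = f⁽ʲ⁺¹⁾ v / 0 = 0`, `(v − v)⁻¹ = 0`).
The honest value there is the LIMIT.  This file reads it:
S1 `exists_tendsto_lineRem_state` — at an `R/2`-isolated state `v` of ANY multiplicity `m` on a legal frame, `lineRem f j v R` has a limit `T` along
   `𝓝[≠] v` (removable singularity: locally `f⁽ʲ⁾ = (z − v)^m·g`, `g(v) ≠ 0`, so `lineRem = g′/g − m/(z − v̄)` off `v`);
S2 `norm_le_of_tendsto_state` — the level-`j` seam `LevelRemainderBox` passes to the limit along the axis below `v`: `‖T‖ ≤ η/s` whenever `Im v ≤ hmax`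
   (lid INCLUDED);
S3 `twoPoint_state` — ★M's binder-free two-point clause passes to the limit in its second point (dominated convergence over the far list on the
   punctured disc of radius `min (R/4) (Im v)` about `v`, where `f⁽ʲ⁾` has no zeros): for every non-zero `z`, `Σ 1/(‖z − aᵢ‖‖v − aᵢ‖) < ∞`,
   `Σ (1/(z − aᵢ) − 1/(v − aᵢ))` converges and equals `lineRem z − T`.
S2/S3 are frame-free (no `EngineHyps5`): S3 is stated over ANY list with ★M's clause, so it is fed by `RhW08.FarPricingM.im_lineRem_eq_farPull_mult` as is.
USE (next file «SinkFeedLid»): a cut AT the state enters C3's `AssemblySig` with read value `T` in place of `lineRem f j v R v` — S2 is its seam bound,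
S3 its two-point data — so ★3m's binder `Im v < hmax` goes.  No def (`T` is a bound variable), no twin of an importable statement.
-/

noncomputable section

namespace RhW08.FarStateRead

open Complex Filter Topology Set
open scoped ComplexConjugate
open RhW08.Round1 RhW08.StSwap RhW08.Round2 RhW08.QuadW
open RhW08.SealSwap (PBot)
open RhW08.SealSwapQ RhW08.RateSplit RhW08.IsolatedTilt RhW08.FarStep RhW08.BurgersRate RhW08.PurseP RhW08.BurgersRateG3
open RhIdea6.G17.W07C7 RhIdea6.G17.W07C7.Rev6 RhIdea6.G18.W07C8.Law421BirthS RhIdea6.G19.W07C11.Seam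
open RhIdea6.G20.W07C12.Frac RhIdea6.G20.W07C12.StColP RhW07.C12.FieldSplit RhIdea6.G21.W07C13.TentMax
open RhW07.C14.TwoSided RhW07.C14.Classes RhW07.C14.Lineage RhW07.C14.Booking
open RhW08.FLink RhW08.FLinkGain RhW08.FLinkGainSeam
open RhW08.GainTwoPoint RhW08.FarPricing RhW08.SinkTemplate RhW08.SinkFeed RhW08.FarTwoPointM RhW08.FarPricingM RhW08.SinkFeedM

/-! ## §R1 The state read: `lineRem` has a limit at the state -/

/-- S1 (K) **THE LINE REMAINDER EXTENDS CONTINUOUSLY INTO THE STATE**: on a legal frame, at an `R/2`-isolated zero `v` of `f⁽ʲ⁾` above the axis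
(any multiplicity), `lineRem f j v R` has a limit along the punctured neighbourhood filter of `v`. -/
theorem exists_tendsto_lineRem_state {η : ℝ} {f : ℂ → ℂ} {x₀ s hmax R Hs : ℝ} {B : ℕ} (hE : EngineHyps5 2 η f x₀ s hmax R Hs B) {j : ℕ}
    {v : ℂ} (hFv : iteratedDeriv j f v = 0) (hv0 : 0 < v.im)
    (hiso : ∀ z : ℂ, iteratedDeriv j f z = 0 → |z.re - v.re| < R / 2 → z = v ∨ z = conj v) :
    ∃ T : ℂ, Tendsto (lineRem f j v R) (𝓝[≠] v) (𝓝 T) := by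
  have hR : 0 < R := RhW08.ClusterQ.R_pos_of_engine hE
  have hFd := differentiable_level hE j
  have hFcv : iteratedDeriv j f (conj v) = 0 := by rw [iteratedDeriv_conj hE, hFv, map_zero]
  -- a non-zero on the axis below `v`, so the multiplicity `m` is finite and positive
  have hc0 : iteratedDeriv j f ⟨v.re, v.im / 2⟩ ≠ 0 := by
    intro hz
    rcases hiso _ hz (by rw [sub_self, abs_zero]; linarith) with h | h
    · have him := congrArg Complex.im h
      simp only at him
      linarith
    · have him := congrArg Complex.im h
      simp only [conj_im] at him
      linarith
  have hm1 : 1 ≤ (analyticOrderAt (iteratedDeriv j f) v).toNat := one_le_order_toNat hE hFv hc0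
  have htop : analyticOrderAt (iteratedDeriv j f) v ≠ ⊤ := by
    intro h
    rw [h, ENat.toNat_top] at hm1
    exact Nat.not_succ_le_zero 0 hm1
  obtain ⟨g, hg, hg0, hfg⟩ := (hFd.analyticAt v).analyticOrderAt_ne_top.mp htop
  obtain ⟨k, hk⟩ : ∃ k : ℕ, analyticOrderNatAt (iteratedDeriv j f) v = k + 1 :=
    Nat.exists_eq_add_one_of_ne_zero (by rw [analyticOrderNatAt]; omega)
  have hfg' : iteratedDeriv j f =ᶠ[𝓝 v] fun z ↦ (z - v) ^ (k + 1) * g z := by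
    filter_upwards [hfg] with z hz
    rw [hz, hk, smul_eq_mul]
  -- the continuous candidate `Φ = g′/g − m/(z − v̄)`
  set Φ : ℂ → ℂ := fun z ↦ deriv g z / g z - ((k + 1 : ℕ) : ℂ) * (z - conj v)⁻¹ with hΦdef
  have hΦc : ContinuousAt Φ v :=
    (hg.deriv.continuousAt.div hg.continuousAt hg0).sub
      (continuousAt_const.mul ((continuousAt_id.sub continuousAt_const).inv₀ (sub_ne_zero.mpr (ne_conj_of_im_pos hv0))))
  -- off `v`, near `v`, the line remainder IS `Φ`
  have hev : lineRem f j v R =ᶠ[𝓝[≠] v] Φ := by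
    have h1 : ∀ᶠ z in 𝓝[≠] v, iteratedDeriv j f =ᶠ[𝓝 z] fun z ↦ (z - v) ^ (k + 1) * g z :=
      hfg'.eventually_nhds.filter_mono nhdsWithin_le_nhds
    have h2 : ∀ᶠ z in 𝓝[≠] v, AnalyticAt ℂ g z := hg.eventually_analyticAt.filter_mono nhdsWithin_le_nhds
    have h3 : ∀ᶠ z in 𝓝[≠] v, g z ≠ 0 := (hg.continuousAt.eventually_ne hg0).filter_mono nhdsWithin_le_nhds
    filter_upwards [h1, h2, h3, self_mem_nhdsWithin] with z hz1 hz2 hz3 hz4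
    have hzv : z - v ≠ 0 := sub_ne_zero.mpr hz4
    have hval : iteratedDeriv j f z = (z - v) ^ (k + 1) * g z := hz1.eq_of_nhds
    have hzc : z - conj v ≠ 0 := by
      intro h
      rw [sub_eq_zero] at h
      have h0 := hval
      rw [h, hFcv] at h0
      rw [h] at hz3
      exact mul_ne_zero (pow_ne_zero _ (sub_ne_zero.mpr (ne_conj_of_im_pos hv0).symm)) hz3 h0.symm
    have hd : HasDerivAt (fun z ↦ (z - v) ^ (k + 1) * g z)
        (((k + 1 : ℕ) : ℂ) * (z - v) ^ (k + 1 - 1) * 1 * g z + (z - v) ^ (k + 1) * deriv g z) z :=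
      (((hasDerivAt_id' z).sub_const v).fun_pow (k + 1)).mul hz2.differentiableAt.hasDerivAt
    have hderiv : iteratedDeriv (j + 1) f z = ((k + 1 : ℕ) : ℂ) * (z - v) ^ k * g z + (z - v) ^ (k + 1) * deriv g z := by
      rw [iteratedDeriv_succ, hz1.deriv_eq, hd.deriv, Nat.add_sub_cancel, mul_one]
    rw [lineRem_eq hiso hFv hFcv hR hv0 z, analyticOrderAt_conj_eq hE, levelField, hderiv, hval, hΦdef]
    have hm : ((analyticOrderAt (iteratedDeriv j f) v).toNat : ℂ) = ((k + 1 : ℕ) : ℂ) := by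
      rw [← hk, analyticOrderNatAt]
    simp only [hm]
    field_simp
    ring
  exact ⟨Φ v, (hΦc.tendsto.mono_left nhdsWithin_le_nhds).congr' hev.symm⟩

/-! ## §R2 The seam passes to the limit -/

/-- S2 (K) **THE SEAM BOUND AT THE STATE**: if the level-`j` seam holds on the box, `v` is `R/2`-isolated with `0 < Im v ≤ hmax` (lid included) in
the column `|Re v − x₀| ≤ R/2`, and `lineRem f j v R → T` along `𝓝[≠] v`, then `‖T‖ ≤ η/s` (read along the axis points `v − it`, `t ↓ 0`,
which are non-zeros of the box by isolation). -/
theorem norm_le_of_tendsto_state {η : ℝ} {f : ℂ → ℂ} {x₀ s hmax R : ℝ} {j : ℕ} (hRB : LevelRemainderBox η f x₀ s hmax R j) {v : ℂ}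
    (hR : 0 < R) (hcol : |v.re - x₀| ≤ R / 2) (hv0 : 0 < v.im) (hvh : v.im ≤ hmax)
    (hiso : ∀ z : ℂ, iteratedDeriv j f z = 0 → |z.re - v.re| < R / 2 → z = v ∨ z = conj v) {T : ℂ}
    (hT : Tendsto (lineRem f j v R) (𝓝[≠] v) (𝓝 T)) : ‖T‖ ≤ η / s := by
  set p : ℝ → ℂ := fun t ↦ v - (t : ℂ) * I with hpdef
  have hpre : ∀ t, (p t).re = v.re := fun t ↦ by simp [hpdef]
  have hpim : ∀ t, (p t).im = v.im - t := fun t ↦ by simp [hpdef]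
  have hpath : Tendsto p (𝓝[>] 0) (𝓝[≠] v) := by
    have hc : Continuous p := by fun_prop
    have h0 : p 0 = v := by simp [hpdef]
    refine tendsto_nhdsWithin_of_tendsto_nhds_of_eventually_within p ?_ ?_
    · simpa only [h0] using (hc.tendsto 0).mono_left nhdsWithin_le_nhds
    · filter_upwards [self_mem_nhdsWithin] with t ht
      intro h
      have him := congrArg Complex.im h
      rw [hpim] at him
      exact (ne_of_gt (mem_Ioi.mp ht)) (by linarith)
  have hbound : ∀ᶠ t in 𝓝[>] 0, ‖lineRem f j v R (p t)‖ ≤ η / s := by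
    filter_upwards [Ioo_mem_nhdsGT hv0] with t ht
    have hp0 : iteratedDeriv j f (p t) ≠ 0 := by
      intro hz
      rcases hiso _ hz (by rw [hpre, sub_self, abs_zero]; linarith) with h | h
      · have him := congrArg Complex.im h
        rw [hpim] at him
        linarith [ht.1]
      · have him := congrArg Complex.im h
        rw [hpim, conj_im] at him
        linarith [ht.2]
    exact norm_lineRem_le_of_seam hRB (hpre t) hcol (by rw [hpim, abs_of_pos (by linarith [ht.2])]; linarith [ht.1]) hp0
  exact le_of_tendsto ((hT.comp hpath).norm) hbound

/-! ## §R3 ★M's two-point clause passes to the limit in its second point -/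

/-- S3 (K) **THE TWO-POINT CLAUSE AT THE STATE**: for ANY list `(aᵢ)` of zeros of `f⁽ʲ⁾` that are `R/2`-far from `Re v` carrying ★M's
binder-free two-point clause (absolute summability of `Σ 1/(‖z − aᵢ‖‖z′ − aᵢ‖)`, convergence of `Σ (1/(z − aᵢ) − 1/(z′ − aᵢ))` to
`lineRem z − lineRem z′` at every pair of non-zeros), and `lineRem f j v R → T` along `𝓝[≠] v`: at every non-zero `z` the clause holds
with second point the state `v` and read value `T` — `Σ 1/(‖z − aᵢ‖‖v − aᵢ‖) < ∞`, and `Σ (1/(z − aᵢ) − 1/(v − aᵢ))` converges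
to `lineRem z − T`. -/
theorem twoPoint_state {f : ℂ → ℂ} {j : ℕ} {v : ℂ} {R : ℝ} (hR : 0 < R) (hv0 : 0 < v.im)
    (hiso : ∀ z : ℂ, iteratedDeriv j f z = 0 → |z.re - v.re| < R / 2 → z = v ∨ z = conj v)
    {ι : Type} {a : ι → ℂ} (hfar : ∀ i, iteratedDeriv j f (a i) = 0 ∧ R / 2 ≤ |(a i).re - v.re|)
    (htwo : ∀ z z' : ℂ, iteratedDeriv j f z ≠ 0 → iteratedDeriv j f z' ≠ 0 →
      Summable (fun i ↦ 1 / (‖z - a i‖ * ‖z' - a i‖)) ∧ Summable (fun i ↦ (1 / (z - a i) - 1 / (z' - a i))) ∧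
        lineRem f j v R z - lineRem f j v R z' = ∑' i, (1 / (z - a i) - 1 / (z' - a i)))
    {T : ℂ} (hT : Tendsto (lineRem f j v R) (𝓝[≠] v) (𝓝 T)) {z : ℂ} (hz : iteratedDeriv j f z ≠ 0) :
    Summable (fun i ↦ 1 / (‖z - a i‖ * ‖v - a i‖)) ∧ Summable (fun i ↦ (1 / (z - a i) - 1 / (v - a i))) ∧
      lineRem f j v R z - T = ∑' i, (1 / (z - a i) - 1 / (v - a i)) := by
  -- `z` and `v` are off the list; the list is `R/2`-far from `v`
  have hza : ∀ i, z ≠ a i := fun i h ↦ hz (by rw [h]; exact (hfar i).1)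
  have hvfar : ∀ i, R / 2 ≤ ‖v - a i‖ := fun i ↦ by
    have h := Complex.abs_re_le_norm (v - a i)
    rw [Complex.sub_re, abs_sub_comm] at h
    exact (hfar i).2.trans h
  have hva : ∀ i, v ≠ a i := fun i h ↦ by
    have h' := hvfar i
    rw [h, sub_self, norm_zero] at h'
    linarith
  have hzpos : ∀ i, 0 < ‖z - a i‖ := fun i ↦ norm_pos_iff.mpr (sub_ne_zero.mpr (hza i))
  have hvpos : ∀ i, 0 < ‖v - a i‖ := fun i ↦ norm_pos_iff.mpr (sub_ne_zero.mpr (hva i))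
  -- (1) mixed summability at `(z, v)` from ★M's absolute clause at `(z, z)` and the far comparison through `v`
  set K : ℝ := 1 + 6 * ‖z - v‖ / R with hKdef
  have hK1 : ∀ i, ‖z - a i‖ ≤ K * ‖v - a i‖ := fun i ↦
    norm_sub_far_le hR (hfar i).2 (by rw [sub_self, abs_zero]; positivity)
  have hmix : Summable (fun i ↦ 1 / (‖z - a i‖ * ‖v - a i‖)) := by
    refine Summable.of_nonneg_of_le (fun i ↦ by positivity) (fun i ↦ ?_) ((htwo z z hz hz).1.mul_left K)
    rw [mul_one_div, div_le_div_iff₀ (mul_pos (hzpos i) (hvpos i)) (mul_pos (hzpos i) (hzpos i)), one_mul]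
    calc ‖z - a i‖ * ‖z - a i‖ ≤ ‖z - a i‖ * (K * ‖v - a i‖) := mul_le_mul_of_nonneg_left (hK1 i) (hzpos i).le
      _ = K * (‖z - a i‖ * ‖v - a i‖) := by ring
  -- the two-point difference in closed form and its norm
  have hdiff : ∀ z' i, z' ≠ a i → 1 / (z - a i) - 1 / (z' - a i) = (z' - z) / ((z - a i) * (z' - a i)) := by
    intro z' i hz'a
    have e1 : z - a i ≠ 0 := sub_ne_zero.mpr (hza i)
    have e2 : z' - a i ≠ 0 := sub_ne_zero.mpr hz'a
    field_simp
    ring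
  have hnorm : ∀ z' i, z' ≠ a i → ‖1 / (z - a i) - 1 / (z' - a i)‖ = ‖z' - z‖ * (1 / (‖z - a i‖ * ‖z' - a i‖)) := by
    intro z' i hz'a
    rw [hdiff z' i hz'a, norm_div, norm_mul, div_eq_mul_one_div]
  -- (2) summability of the differences at `(z, v)`
  have hSv : Summable (fun i ↦ (1 / (z - a i) - 1 / (v - a i))) :=
    Summable.of_norm_bounded (hmix.mul_left ‖v - z‖) fun i ↦ (hnorm v i (hva i)).le
  refine ⟨hmix, hSv, ?_⟩
  -- (3) dominated convergence on the punctured disc of radius `r = min (R/4) (Im v)` about `v`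
  set r : ℝ := min (R / 4) v.im with hrdef
  have hr0 : 0 < r := lt_min (by linarith) hv0
  have hrR : r ≤ R / 4 := min_le_left _ _
  have hrv : r ≤ v.im := min_le_right _ _
  have hnear : ∀ᶠ z' in 𝓝[≠] v, ‖z' - v‖ < r ∧ z' ≠ v := by
    filter_upwards [mem_nhdsWithin_of_mem_nhds (Metric.ball_mem_nhds v hr0), self_mem_nhdsWithin] with z' hb hne
    exact ⟨by rwa [Metric.mem_ball, dist_eq_norm] at hb, hne⟩
  -- there: no zeros of `f⁽ʲ⁾` (isolation; `v̄` is at distance `2·Im v`), and the list stays at half its distance from `v`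
  have hnz : ∀ z', ‖z' - v‖ < r → z' ≠ v → iteratedDeriv j f z' ≠ 0 := by
    intro z' hb hne hz'
    have hre : |z'.re - v.re| < R / 2 := by
      have h := Complex.abs_re_le_norm (z' - v)
      rw [Complex.sub_re] at h
      linarith
    rcases hiso z' hz' hre with h | h
    · exact hne h
    · rw [h] at hb
      have h2 := Complex.abs_im_le_norm (conj v - v)
      rw [Complex.sub_im, conj_im, show -v.im - v.im = -(2 * v.im) by ring, abs_neg, abs_of_pos (by linarith)] at h2
      linarith
  have hhalf : ∀ z' i, ‖z' - v‖ < r → ‖v - a i‖ ≤ 2 * ‖z' - a i‖ := by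
    intro z' i hb
    have h1 := norm_sub_le_norm_sub_add_norm_sub v z' (a i)
    rw [norm_sub_rev v z'] at h1
    linarith [hvfar i]
  -- termwise limits and the summable domination
  have hab : ∀ i, Tendsto (fun z' ↦ 1 / (z - a i) - 1 / (z' - a i)) (𝓝[≠] v) (𝓝 (1 / (z - a i) - 1 / (v - a i))) := by
    intro i
    have hc : ContinuousAt (fun z' ↦ 1 / (z - a i) - 1 / (z' - a i)) v :=
      continuousAt_const.sub ((continuousAt_const.div (continuousAt_id.sub continuousAt_const) (sub_ne_zero.mpr (hva i))))
    exact hc.tendsto.mono_left nhdsWithin_le_nhds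
  have hdom : ∀ᶠ z' in 𝓝[≠] v, ∀ i, ‖1 / (z - a i) - 1 / (z' - a i)‖ ≤ (‖v - z‖ + r) * (2 * (1 / (‖z - a i‖ * ‖v - a i‖))) := by
    filter_upwards [hnear] with z' hz' i
    have hz'a : z' ≠ a i := fun h ↦ hnz z' hz'.1 hz'.2 (by rw [h]; exact (hfar i).1)
    have hz'pos : 0 < ‖z' - a i‖ := norm_pos_iff.mpr (sub_ne_zero.mpr hz'a)
    rw [hnorm z' i hz'a]
    refine mul_le_mul ?_ ?_ (by positivity) (by positivity)
    · have h1 := norm_sub_le_norm_sub_add_norm_sub z' v z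
      linarith [hz'.1]
    · rw [mul_one_div, div_le_div_iff₀ (mul_pos (hzpos i) hz'pos) (mul_pos (hzpos i) (hvpos i)), one_mul]
      calc ‖z - a i‖ * ‖v - a i‖ ≤ ‖z - a i‖ * (2 * ‖z' - a i‖) := mul_le_mul_of_nonneg_left (hhalf z' i hz'.1) (hzpos i).le
        _ = 2 * (‖z - a i‖ * ‖z' - a i‖) := by ring
  have hlim1 : Tendsto (fun z' ↦ ∑' i, (1 / (z - a i) - 1 / (z' - a i))) (𝓝[≠] v)
      (𝓝 (∑' i, (1 / (z - a i) - 1 / (v - a i)))) :=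
    tendsto_tsum_of_dominated_convergence ((hmix.mul_left 2).mul_left (‖v - z‖ + r)) hab hdom
  -- the same sums are `lineRem z − lineRem z′`, which tends to `lineRem z − T`
  have hev : (fun z' ↦ lineRem f j v R z - lineRem f j v R z') =ᶠ[𝓝[≠] v] fun z' ↦ ∑' i, (1 / (z - a i) - 1 / (z' - a i)) := by
    filter_upwards [hnear] with z' hz'
    exact (htwo z z' hz (hnz z' hz'.1 hz'.2)).2.2
  have hlim2 : Tendsto (fun z' ↦ lineRem f j v R z - lineRem f j v R z') (𝓝[≠] v) (𝓝 (lineRem f j v R z - T)) :=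
    tendsto_const_nhds.sub hT
  exact tendsto_nhds_unique (hlim2.congr' hev) hlim1

end RhW08.FarStateRead

end
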